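import Summits.HodgeConjecture.HodgeConjecture.Theorems.HeckePrymWeilHodgeWeilOfWeilTransport
import Summits.HodgeConjecture.HodgeConjecture.Theorems.HeckePrymWeilWeilSixfoldsSqrtMinus7MarkmanSplit
import HarnessLib

/-!
# Crux `WeilSixfoldsSqrtMinus7` ⟺ variational Hodge for flat WEIL classes of `√-7`-sixfold families (modulo M3)

Route `HeckePrymWeil` (sub-problem `HodgeConjecture`); lead seat c6 of crux `WeilSixfoldsSqrtMinus7`
(stmt-HodgeConjecture-1260), line `hyperbolic-eightfold-descent`, skeleton r7 — the instance
`(p, k) = (7, 3)` of `HeckePrymWeilHodgeWeilOfWeilTransport` (lead c5 of the sibling crux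
`WeilTwelvefoldsSqrtMinus7`, which landed the `(7, 6)` instance), recorded for THIS crux as its tightness
certificate, and combined with the Markman split of r7 (`HeckePrymWeilWeilSixfoldsSqrtMinus7MarkmanSplit`):

* `weilSixfoldsSqrtMinus7_of_weilTransport_of_levelStructure` — crux ⟸ M3
  (`deligne1982_weilFamily_levelStructure`, Deligne's level-`n` abelian scheme with `𝒪_K`-action) + the
  Weil transport `WT(7, 3)` (variational Hodge for global classes fibrewise in the Weil plane of a chart,
  along smooth projective families of `√-7`-abelian sixfolds over smooth irreducible bases);
* `weilTransport_three_of_weilSixfoldsSqrtMinus7` — TIGHTNESS: crux ⟹ `WT(7, 3)` (no family needed);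
* `weilSixfoldsSqrtMinus7_iff_weilTransport_of_levelStructure` — modulo M3, crux ⟺ `WT(7, 3)`;
* `weilTransport_three_of_weilVariationalHodge` — `WT(7, 3) ⟸ WeilVariationalHodge` (stmt-14497);
* `nonHyperbolic_iff_weilTransport_of_markmanSplit_of_levelStructure` — modulo M3 AND Markman's
  split-sixfold theorem (the named fact `Markman2025_weilClasses_algebraic_hyperbolicSixfold` = r7's
  `stub_markmanSplit`), r7's open stub `stub_nonHyperbolicSixfolds` (the NON-split residual) ⟺ `WT(7, 3)`:
  the residual, the crux and the Weil transport at `(7, 3)` are one and the same open statement.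

So item stmt-HodgeConjecture-1260 is, given the literature construction M3, EXACTLY "variational Hodge
for flat Weil classes of `√-7`-sixfold families" — an HC-implied instance of `WeilVariationalHodge`
(stmt-HodgeConjecture-14497); no reduction is left inside either checked line.  CONDITIONAL on the
hypotheses spelled out; no `sorry`, no new definition.
-/

noncomputable section

-- every declaration of this problem lives in `Summit.HodgeConjecture.HodgeConjecture.…` (summit = sub-problem)
set_option linter.dupNamespace false

open CategoryTheory AlgebraicGeometry Limits MonoidalCategory CartesianMonoidalCategory

namespace Summit.HodgeConjecture.HodgeConjecture.Theorems.HeckePrymWeilLine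

open Literature.AlgebraicGeometry Literature.AlgebraicGeometry.Motives Literature.AlgebraicGeometry.HodgeTheory
open Literature.AlgebraicTopology.SingularHomology
open Summit.HodgeConjecture.HodgeConjecture.Theses.HeckePrymWeil

/-! ### The crux `WeilSixfoldsSqrtMinus7` at `(p, k) = (7, 3)` -/

/-- **The crux `WeilSixfoldsSqrtMinus7` (stmt-HodgeConjecture-1260) from Deligne's level-`n` abelian
scheme (`deligne1982_weilFamily_levelStructure`, M3) and the WEIL transport at `(7, 3)`** — variational
Hodge for global classes fibrewise in the Weil plane of a chart, along smooth projective families of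
`√-7`-abelian sixfolds over smooth irreducible bases (CONDITIONAL result).
[cite: Deligne1982HodgeCycles, proof of Thm. 4.8 (the group Γ, n ≥ 3), Lemma 4.5, Remark 4.10]
[cite: Grothendieck1966, footnote 13] -/
theorem weilSixfoldsSqrtMinus7_of_weilTransport_of_levelStructure
    (hLS : deligne1982_weilFamily_levelStructure)
    (hT : ∀ ⦃𝒳 S : SchemeOver ℂ⦄ (f : 𝒳 ⟶ S), IsSmoothProjectiveFamily f (2 * 3) →
      IrreducibleSpace S.left → AlgebraicGeometry.Smooth S.hom →
      ∀ (W : complexBetti 𝒳 (2 * 3)),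
        (∀ s : ComplexPoints S, IsRationalClass (complexBetti.map (fiberι f s) (2 * 3) W) ∧
          IsOfHodgeType (2 * 3) (fiberOver f s) (2 * 3) 3 3 (complexBetti.map (fiberι f s) (2 * 3) W)) →
        (∀ s : ComplexPoints S, ∃ (A' : AbelianVariety ℂ) (φ' : A' ⟶ A') (e' : A'.X ≅ fiberOver f s),
          A'.dim = 2 * 3 ∧ φ' ≫ φ' = -(((7 : ℕ) : ℤ) • 𝟙 A') ∧
          complexBetti.map e'.hom (2 * 3) (complexBetti.map (fiberι f s) (2 * 3) W) ∈
            weilClassesOf A' φ' 3 7) →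
        (∃ s₀ : ComplexPoints S,
          complexBetti.map (fiberι f s₀) (2 * 3) W ∈ algebraicClasses (fiberOver f s₀) 3) →
        ∀ s : ComplexPoints S,
          complexBetti.map (fiberι f s) (2 * 3) W ∈ algebraicClasses (fiberOver f s) 3) :
    WeilSixfoldsSqrtMinus7 := by
  intro A φ hA hφ c hrat hH hW
  exact hodgeWeil_of_weilTransport_of_globalAction
    (deligne1982_weilFamily_globalAction_of_kAction (deligne1982_weilFamily_kAction_of_levelStructure hLS))
    (p := 7) (by norm_num) (by norm_num) le_rfl (k := 3) (by norm_num) hT A φ hA (by exact_mod_cast hφ) c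
    hrat hH (by exact_mod_cast hW)

/-- **Tightness at `(7, 3)`: the crux implies the Weil transport at `(7, 3)`** (no family structure
needed). [cite: vanGeemen1994HodgeAV, 4.9] [cite: Fulton1998, §19.1] -/
theorem weilTransport_three_of_weilSixfoldsSqrtMinus7 (h : WeilSixfoldsSqrtMinus7) :
    ∀ ⦃𝒳 S : SchemeOver ℂ⦄ (f : 𝒳 ⟶ S), IsSmoothProjectiveFamily f (2 * 3) →
      IrreducibleSpace S.left → AlgebraicGeometry.Smooth S.hom →
      ∀ (W : complexBetti 𝒳 (2 * 3)),
        (∀ s : ComplexPoints S, IsRationalClass (complexBetti.map (fiberι f s) (2 * 3) W) ∧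
          IsOfHodgeType (2 * 3) (fiberOver f s) (2 * 3) 3 3 (complexBetti.map (fiberι f s) (2 * 3) W)) →
        (∀ s : ComplexPoints S, ∃ (A' : AbelianVariety ℂ) (φ' : A' ⟶ A') (e' : A'.X ≅ fiberOver f s),
          A'.dim = 2 * 3 ∧ φ' ≫ φ' = -(((7 : ℕ) : ℤ) • 𝟙 A') ∧
          complexBetti.map e'.hom (2 * 3) (complexBetti.map (fiberι f s) (2 * 3) W) ∈
            weilClassesOf A' φ' 3 7) →
        (∃ s₀ : ComplexPoints S,
          complexBetti.map (fiberι f s₀) (2 * 3) W ∈ algebraicClasses (fiberOver f s₀) 3) →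
        ∀ s : ComplexPoints S,
          complexBetti.map (fiberι f s) (2 * 3) W ∈ algebraicClasses (fiberOver f s) 3 := by
  refine weilTransport_of_hodgeWeil (p := 7) (k := 3) fun A φ hA hφ c hrat hH hW ↦ ?_
  exact h A φ hA (by exact_mod_cast hφ) c hrat hH (by exact_mod_cast hW)

/-- **MODULO M3, the crux `WeilSixfoldsSqrtMinus7` is EQUIVALENT to the Weil transport at `(7, 3)`**
— the certificate that neither checked line of the crux reduces anything further: item
stmt-HodgeConjecture-1260 is exactly "variational Hodge for flat Weil classes of `√-7`-sixfold
families", an instance of `WeilVariationalHodge` (stmt-HodgeConjecture-14497,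
`weilTransport_of_transport`). [cite: Deligne1982HodgeCycles, proof of Thm. 4.8]
[cite: Grothendieck1966, footnote 13] -/
theorem weilSixfoldsSqrtMinus7_iff_weilTransport_of_levelStructure
    (hLS : deligne1982_weilFamily_levelStructure) :
    WeilSixfoldsSqrtMinus7 ↔
    (∀ ⦃𝒳 S : SchemeOver ℂ⦄ (f : 𝒳 ⟶ S), IsSmoothProjectiveFamily f (2 * 3) →
      IrreducibleSpace S.left → AlgebraicGeometry.Smooth S.hom →
      ∀ (W : complexBetti 𝒳 (2 * 3)),
        (∀ s : ComplexPoints S, IsRationalClass (complexBetti.map (fiberι f s) (2 * 3) W) ∧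
          IsOfHodgeType (2 * 3) (fiberOver f s) (2 * 3) 3 3 (complexBetti.map (fiberι f s) (2 * 3) W)) →
        (∀ s : ComplexPoints S, ∃ (A' : AbelianVariety ℂ) (φ' : A' ⟶ A') (e' : A'.X ≅ fiberOver f s),
          A'.dim = 2 * 3 ∧ φ' ≫ φ' = -(((7 : ℕ) : ℤ) • 𝟙 A') ∧
          complexBetti.map e'.hom (2 * 3) (complexBetti.map (fiberι f s) (2 * 3) W) ∈
            weilClassesOf A' φ' 3 7) →
        (∃ s₀ : ComplexPoints S,
          complexBetti.map (fiberι f s₀) (2 * 3) W ∈ algebraicClasses (fiberOver f s₀) 3) →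
        ∀ s : ComplexPoints S,
          complexBetti.map (fiberι f s) (2 * 3) W ∈ algebraicClasses (fiberOver f s) 3) :=
  ⟨weilTransport_three_of_weilSixfoldsSqrtMinus7,
    weilSixfoldsSqrtMinus7_of_weilTransport_of_levelStructure hLS⟩

/-- **The Weil transport at `(7, 3)` from `WeilVariationalHodge`** (stmt-HodgeConjecture-14497 at
`p = 7`, `M = 3`). [cite: Grothendieck1966, footnote 13] [cite: CharlesSchnell2014Notes, Conj. 11.3.1] -/
theorem weilTransport_three_of_weilVariationalHodge (hV : WeilVariationalHodge) :
    ∀ ⦃𝒳 S : SchemeOver ℂ⦄ (f : 𝒳 ⟶ S), IsSmoothProjectiveFamily f (2 * 3) →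
      IrreducibleSpace S.left → AlgebraicGeometry.Smooth S.hom →
      ∀ (W : complexBetti 𝒳 (2 * 3)),
        (∀ s : ComplexPoints S, IsRationalClass (complexBetti.map (fiberι f s) (2 * 3) W) ∧
          IsOfHodgeType (2 * 3) (fiberOver f s) (2 * 3) 3 3 (complexBetti.map (fiberι f s) (2 * 3) W)) →
        (∀ s : ComplexPoints S, ∃ (A' : AbelianVariety ℂ) (φ' : A' ⟶ A') (e' : A'.X ≅ fiberOver f s),
          A'.dim = 2 * 3 ∧ φ' ≫ φ' = -(((7 : ℕ) : ℤ) • 𝟙 A') ∧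
          complexBetti.map e'.hom (2 * 3) (complexBetti.map (fiberι f s) (2 * 3) W) ∈
            weilClassesOf A' φ' 3 7) →
        (∃ s₀ : ComplexPoints S,
          complexBetti.map (fiberι f s₀) (2 * 3) W ∈ algebraicClasses (fiberOver f s₀) 3) →
        ∀ s : ComplexPoints S,
          complexBetti.map (fiberι f s) (2 * 3) W ∈ algebraicClasses (fiberOver f s) 3 :=
  weilTransport_of_transport (hV 7 (by norm_num) (by norm_num) le_rfl 3 (by norm_num))

/-! ### With the Markman split (skeleton r7): the non-split residual ⟺ the Weil transport -/

/-- **MODULO M3 and Markman's split-sixfold theorem, r7's open stub — the NON-SPLIT RESIDUAL — is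
EQUIVALENT to the Weil transport at `(7, 3)`.**  Given the named facts
`deligne1982_weilFamily_levelStructure` (M3) and `Markman2025_weilClasses_algebraic_hyperbolicSixfold`
(arXiv:2502.03415 Thm. 1.5.1 = r7's `stub_markmanSplit`): the crux restricted to the pairs `(A, φ)`
admitting NO hyperbolic `K`-symmetrised hyperplane class (r7's `stub_nonHyperbolicSixfolds`, open in
print: arXiv:2603.20268 p. 3) holds iff `WT(7, 3)` does — through the crux, by
`MarkmanSplit.weilSixfoldsSqrtMinus7_iff_nonHyperbolic_of_markmanSplit` (p124364) and
`weilSixfoldsSqrtMinus7_iff_weilTransport_of_levelStructure`. [cite: Markman2025SecantWeil, Thm. 1.5.1]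
[cite: Deligne1982HodgeCycles, proof of Thm. 4.8] [cite: Grothendieck1966, footnote 13] -/
theorem nonHyperbolic_iff_weilTransport_of_markmanSplit_of_levelStructure
    (hS : Markman2025_weilClasses_algebraic_hyperbolicSixfold)
    (hLS : deligne1982_weilFamily_levelStructure) :
    (∀ (A : AbelianVariety ℂ) (φ : A ⟶ A), A.dim = 6 → φ ≫ φ = -((7 : ℤ) • 𝟙 A) →
        (∀ (e : ProjectiveEmbedding A.X) (a : complexBetti (projectiveSpace e.n ℂ) 2),
            IsRationalClass a → a ≠ 0 →
              ¬ IsHyperbolicWeilType A φ 3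
                ((7 : ℂ) • complexBetti.map e.ι 2 a +
                  complexBetti.map φ.hom.hom.hom 2 (complexBetti.map e.ι 2 a))) →
          ∀ c : complexBetti A.X 6, IsRationalClass c → IsOfHodgeType 6 A.X 6 3 3 c →
            c ∈ Module.End.eigenspace (complexBetti.map (𝟙 A + φ).hom.hom.hom 6).hom
                  ((1 + Complex.I * (Real.sqrt (7 : ℝ) : ℂ)) ^ 6) ⊔
                Module.End.eigenspace (complexBetti.map (𝟙 A + φ).hom.hom.hom 6).hom
                  ((1 - Complex.I * (Real.sqrt (7 : ℝ) : ℂ)) ^ 6) →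
              c ∈ algebraicClasses A.X 3) ↔
    (∀ ⦃𝒳 S : SchemeOver ℂ⦄ (f : 𝒳 ⟶ S), IsSmoothProjectiveFamily f (2 * 3) →
      IrreducibleSpace S.left → AlgebraicGeometry.Smooth S.hom →
      ∀ (W : complexBetti 𝒳 (2 * 3)),
        (∀ s : ComplexPoints S, IsRationalClass (complexBetti.map (fiberι f s) (2 * 3) W) ∧
          IsOfHodgeType (2 * 3) (fiberOver f s) (2 * 3) 3 3 (complexBetti.map (fiberι f s) (2 * 3) W)) →
        (∀ s : ComplexPoints S, ∃ (A' : AbelianVariety ℂ) (φ' : A' ⟶ A') (e' : A'.X ≅ fiberOver f s),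
          A'.dim = 2 * 3 ∧ φ' ≫ φ' = -(((7 : ℕ) : ℤ) • 𝟙 A') ∧
          complexBetti.map e'.hom (2 * 3) (complexBetti.map (fiberι f s) (2 * 3) W) ∈
            weilClassesOf A' φ' 3 7) →
        (∃ s₀ : ComplexPoints S,
          complexBetti.map (fiberι f s₀) (2 * 3) W ∈ algebraicClasses (fiberOver f s₀) 3) →
        ∀ s : ComplexPoints S,
          complexBetti.map (fiberι f s) (2 * 3) W ∈ algebraicClasses (fiberOver f s) 3) :=
  (Summit.HodgeConjecture.HodgeConjecture.Theorems.WeilSixfoldsSqrtMinus7.MarkmanSplit.weilSixfoldsSqrtMinus7_iff_nonHyperbolic_of_markmanSplit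
      hS).symm.trans
    (weilSixfoldsSqrtMinus7_iff_weilTransport_of_levelStructure hLS)

/-! ### Registered form (sub-goal of stmt-HodgeConjecture-1260, fully qualified) -/

/-- **Registered sub-goal `weilSixfoldsSqrtMinus7_iff_weilTransport_three` of the crux item
stmt-HodgeConjecture-1260** — `weilSixfoldsSqrtMinus7_iff_weilTransport_of_levelStructure` with the
M3 hypothesis as an arrow and every constant fully qualified (the shape under which the sub-goal is
registered on the ledger): modulo `deligne1982_weilFamily_levelStructure`, the crux ⟺ `WT(7, 3)`.
[cite: Deligne1982HodgeCycles, proof of Thm. 4.8] [cite: Grothendieck1966, footnote 13] -/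
theorem weilSixfoldsSqrtMinus7_iff_weilTransport_three :
    Literature.AlgebraicGeometry.HodgeTheory.deligne1982_weilFamily_levelStructure → (Summit.HodgeConjecture.HodgeConjecture.Theses.HeckePrymWeil.WeilSixfoldsSqrtMinus7 ↔ ∀ ⦃𝒳 S : Literature.AlgebraicGeometry.Motives.SchemeOver ℂ⦄ (f : 𝒳 ⟶ S), Literature.AlgebraicGeometry.Motives.IsSmoothProjectiveFamily f (2 * 3) → IrreducibleSpace S.left → AlgebraicGeometry.Smooth S.hom → ∀ W : Literature.AlgebraicGeometry.HodgeTheory.complexBetti 𝒳 (2 * 3), (∀ s : Literature.AlgebraicGeometry.Motives.ComplexPoints S, Literature.AlgebraicGeometry.HodgeTheory.IsRationalClass (Literature.AlgebraicGeometry.HodgeTheory.complexBetti.map (Literature.AlgebraicGeometry.Motives.fiberι f s) (2 * 3) W) ∧ Literature.AlgebraicGeometry.HodgeTheory.IsOfHodgeType (2 * 3) (Literature.AlgebraicGeometry.Motives.fiberOver f s) (2 * 3) 3 3 (Literature.AlgebraicGeometry.HodgeTheory.complexBetti.map (Literature.AlgebraicGeometry.Motives.fiberι f s) (2 * 3) W))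 → (∀ s : Literature.AlgebraicGeometry.Motives.ComplexPoints S, ∃ (A' : Literature.AlgebraicGeometry.Motives.AbelianVariety ℂ) (φ' : A' ⟶ A') (e' : A'.X ≅ Literature.AlgebraicGeometry.Motives.fiberOver f s), A'.dim = 2 * 3 ∧ CategoryTheory.CategoryStruct.comp φ' φ' = -(((7 : ℕ) : ℤ) • CategoryTheory.CategoryStruct.id A') ∧ Literature.AlgebraicGeometry.HodgeTheory.complexBetti.map e'.hom (2 * 3) (Literature.AlgebraicGeometry.HodgeTheory.complexBetti.map (Literature.AlgebraicGeometry.Motives.fiberι f s) (2 * 3) W) ∈ Literature.AlgebraicGeometry.HodgeTheory.weilClassesOf A' φ' 3 7) → (∃ s₀ : Literature.AlgebraicGeometry.Motives.ComplexPoints S, Literature.AlgebraicGeometry.HodgeTheory.complexBetti.map (Literature.AlgebraicGeometry.Motives.fiberι f s₀) (2 * 3) W ∈ Literature.AlgebraicGeometry.HodgeTheory.algebraicClasses (Literature.AlgebraicGeometry.Motives.fiberOver f s₀) 3) → ∀ s : Literature.AlgebraicGeometry.Motives.ComplexPoints S, Literature.AlgebraicGeometry.HodgeTheory.complexBetti.map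 (Literature.AlgebraicGeometry.Motives.fiberι f s) (2 * 3) W ∈ Literature.AlgebraicGeometry.HodgeTheory.algebraicClasses (Literature.AlgebraicGeometry.Motives.fiberOver f s) 3) :=
  fun hLS ↦ weilSixfoldsSqrtMinus7_iff_weilTransport_of_levelStructure hLS

end Summit.HodgeConjecture.HodgeConjecture.Theorems.HeckePrymWeilLine

end
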